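import Summits.Ventures.HodgeRepro2.A2LamPowers
import Summits.Ventures.HodgeRepro2.A2LamAdjoint
import Summits.Ventures.HodgeRepro2.A2CoproductMain
import Summits.Ventures.HodgeRepro2.A2PontryaginModel

/-!
# The Pontryagin product with `θ^k` is the dual Lefschetz power (A2 annex, operator identity — part 5)

**Theorem** (`pontryagin_theta_pow_eq_smul_lam_pow`). In the twelve-plane model, for every class `z`,
every `k ≤ n = |ι|` and every `θ = Σ_p c_p E_p` with all `c_p ≠ 0`,

  `z ⋆ θ^k = (k!/(n−k)!) · (∏_p c_p) · vol • Λ^{n−k} z`,   `Λ = Σ_p c_p⁻¹ Λ_p`,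

i.e. the Pontryagin product with `θ^k` (row 92's `pontryagin z (theta c ^ k)`, the class
`y = m_*(z ⊗ θ^k)` of Theorem A for `k = 4`) IS the power `Λ^{n−k}` of the dual Lefschetz
operator of row 101 up to the explicit constant.  Consequences: `z ⋆ θ^n = n!(∏ c_p) vol • z`,
`z ⋆ 1 = (∏ c_p) vol / n! • Λ^n z`, and — since `Λ^{n−k} L^{n−k} = ((n−k)!)²` on primitive classes
of degree `k` — the proportionality `p_W(z ⋆ θ^k) = (n−k)!·k!·(∏ c_p)·vol • p_W((L^{n−k})^{-1} z)`
of row 104 is the primitive case of this identity.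

The proof pairs both sides against a plane-sorted monomial `u` (`A2PlaneMonomials`): the left
side is `II (inl z * inr θ^k * cop u)` (row 92), which `A2CoproductMain` evaluates as
`Σ_{S ⊆ E(u), |S| = n−k} ∫_B z ∧ (u∖S) · k! c_{S^c} vol`; the right side is
`κ' ∫_B z ∧ Λ^{n−k} u` (self-adjointness, `A2LamAdjoint`), which `A2LamPowers` evaluates as
`κ' (n−k)! Σ_{|S| = n−k, S ⊆ E(u)} c_S⁻¹ ∫_B z ∧ (u∖S)`; the two agree term by term because
`c_{S^c} = (∏ c_p) c_S⁻¹`.  The monomial basis extends the identity to all `u`, and the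
perfectness of the pairing (row 90's `dualOf`) gives the identity of classes.
-/

namespace Summit.Ventures.HodgeRepro2.A2PontryaginLefschetz

open WeilPlanes WeilIntegral WeilCoproduct WeilPairing A2PlaneMonomials A2LamPowers A2LamAdjoint
  A2CoproductMain A2HardLefschetzOps A2PontryaginModel A2ModelDuality

variable {ι : Type*} [DecidableEq ι] [Fintype ι]

/-- The constant `κ'_k = k!·(∏_p c_p)·vol / (n−k)!`. -/
noncomputable def kappa' (c : ι → ℂ) (k : ℕ) : ℂ :=
  ((k.factorial : ℂ) * ∏ p, c p) * vol ι / ((Fintype.card ι - k).factorial : ℂ)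

/-- `κ'_k ≠ 0` when every `c_p ≠ 0`. -/
lemma kappa'_ne_zero {c : ι → ℂ} (hc : ∀ p, c p ≠ 0) (k : ℕ) : kappa' c k ≠ 0 := by
  unfold kappa'
  refine div_ne_zero (mul_ne_zero (mul_ne_zero ?_ ?_) (vol_ne_zero ι)) ?_
  · exact_mod_cast Nat.factorial_ne_zero k
  · exact Finset.prod_ne_zero_iff.2 fun p _ => hc p
  · exact_mod_cast Nat.factorial_ne_zero _

/-- The pairing of `z ⋆ θ^k` against a plane-sorted monomial, from `A2CoproductMain`. -/
theorem integral_pontryagin_theta_pow_mul_planeProd (z : A ι) (c : ι → ℂ) (k : ℕ)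
    (m : ι → Bool × Bool) :
    integral (pontryagin z (theta c ^ k) * planeProd Finset.univ.toList m) =
      ∑ S ∈ (Eplanes Finset.univ.toList m).powerset,
        integral (z * planeProd Finset.univ.toList (eraseS m S)) *
          (if (Finset.univ \ S).card = k then
            ((k.factorial : ℂ) * ∏ p ∈ Finset.univ \ S, c p) * vol ι else 0) := by
  rw [integral_pontryagin_mul, II_pair_cop_planeProd (Finset.nodup_toList _)]

/-- The pairing of `z` against `Λ^j` of a plane-sorted monomial, from `A2LamPowers`. -/
theorem integral_mul_lam_pow_planeProd (z : A ι) (c : ι → ℂ) (j : ℕ) (m : ι → Bool × Bool) :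
    integral (z * (lam c ^ j) (planeProd Finset.univ.toList m)) =
      (j.factorial : ℂ) * ∑ T ∈ Finset.powersetCard j Finset.univ,
        if ∀ p ∈ T, p ∈ Finset.univ.toList ∧ m p = (true, true) then
          (∏ p ∈ T, (c p)⁻¹) * integral (z * planeProd Finset.univ.toList (eraseS m T)) else 0 := by
  rw [lam_pow_planeProd c j (Finset.nodup_toList _), mul_smul_comm, map_smul, Finset.mul_sum,
    map_sum, smul_eq_mul]
  congr 1
  refine Finset.sum_congr rfl fun T _ => ?_
  split_ifs
  · rw [mul_smul_comm, map_smul, smul_eq_mul]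
  · rw [mul_zero, map_zero]

/-- The two index sets of the main computation agree: the sets `S` of `E`-planes of `u` with
`|univ ∖ S| = k` are the sets of `n − k` planes all carrying `E_p` in `u`. -/
lemma filter_powerset_eq {k : ℕ} (hk : k ≤ Fintype.card ι) (m : ι → Bool × Bool) :
    (Eplanes Finset.univ.toList m).powerset.filter (fun S => (Finset.univ \ S).card = k) =
      (Finset.powersetCard (Fintype.card ι - k) Finset.univ).filter
        (fun T => ∀ p ∈ T, p ∈ Finset.univ.toList ∧ m p = (true, true)) := by
  ext S
  rw [Finset.mem_filter, Finset.mem_filter, Finset.mem_powerset, Finset.mem_powersetCard,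
    Finset.card_univ_sdiff]
  have h2 : S.card ≤ Fintype.card ι := Finset.card_le_univ S
  constructor
  · rintro ⟨hS, hc⟩
    exact ⟨⟨Finset.subset_univ S, by omega⟩, fun p hp => mem_Eplanes.1 (hS hp)⟩
  · rintro ⟨⟨-, hc⟩, hS⟩
    exact ⟨fun p hp => mem_Eplanes.2 (hS p hp), by omega⟩

/-- **The key identity on plane-sorted monomials**: `∫_B (z ⋆ θ^k) ∧ u = κ' ∫_B z ∧ Λ^{n−k} u`. -/
theorem integral_pontryagin_mul_planeProd_eq {c : ι → ℂ} (hc : ∀ p, c p ≠ 0) {k : ℕ}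
    (hk : k ≤ Fintype.card ι) (z : A ι) (m : ι → Bool × Bool) :
    integral (pontryagin z (theta c ^ k) * planeProd Finset.univ.toList m) =
      kappa' c k *
        integral (z * (lam c ^ (Fintype.card ι - k)) (planeProd Finset.univ.toList m)) := by
  rw [integral_pontryagin_theta_pow_mul_planeProd, integral_mul_lam_pow_planeProd]
  simp only [mul_ite, mul_zero]
  rw [← Finset.sum_filter, ← Finset.sum_filter, filter_powerset_eq hk, Finset.mul_sum,
    Finset.mul_sum]
  refine Finset.sum_congr rfl fun S _ => ?_
  have hprod : (∏ p ∈ Finset.univ \ S, c p) * ∏ p ∈ S, c p = ∏ p, c p :=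
    Finset.prod_sdiff (Finset.subset_univ S)
  have hS0 : ∏ p ∈ S, c p ≠ 0 := Finset.prod_ne_zero_iff.2 fun p _ => hc p
  have hfac : ((Fintype.card ι - k).factorial : ℂ) ≠ 0 := by
    exact_mod_cast Nat.factorial_ne_zero _
  rw [kappa', Finset.prod_inv_distrib, ← hprod]
  field_simp

/-- The pairing identity for every `u`, by the monomial basis. -/
theorem integral_pontryagin_theta_pow_mul {c : ι → ℂ} (hc : ∀ p, c p ≠ 0) {k : ℕ}
    (hk : k ≤ Fintype.card ι) (z u : A ι) :
    integral (pontryagin z (theta c ^ k) * u) =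
      kappa' c k * integral (z * (lam c ^ (Fintype.card ι - k)) u) := by
  have key : (integral ∘ₗ LinearMap.mulLeft ℂ (pontryagin z (theta c ^ k))) =
      kappa' c k • (integral ∘ₗ LinearMap.mulLeft ℂ z ∘ₗ (lam c ^ (Fintype.card ι - k))) := by
    refine aBasis.ext fun s => ?_
    obtain ⟨ε, -, hε⟩ := exists_sign_aBasis s
    simp only [LinearMap.comp_apply, LinearMap.mulLeft_apply, LinearMap.smul_apply, hε, map_smul,
      smul_eq_mul]
    rw [integral_pontryagin_mul_planeProd_eq hc hk]
  have := LinearMap.congr_fun key u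
  simpa using this

/-- **THE OPERATOR IDENTITY**: `z ⋆ θ^k = κ'_k • Λ^{n−k} z` for every `z`, every `k ≤ n` and every
`θ = Σ_p c_p E_p` with all `c_p ≠ 0` — the Pontryagin product with `θ^k` is the `(n−k)`-th power of
the dual Lefschetz operator `Λ = Σ_p c_p⁻¹ Λ_p`, up to the constant `κ'_k = k!(∏ c_p) vol/(n−k)!`. -/
theorem pontryagin_theta_pow_eq_smul_lam_pow {c : ι → ℂ} (hc : ∀ p, c p ≠ 0) {k : ℕ}
    (hk : k ≤ Fintype.card ι) (z : A ι) :
    pontryagin z (theta c ^ k) = kappa' c k • (lam c ^ (Fintype.card ι - k)) z := by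
  symm
  apply pontryagin_unique
  intro u
  rw [← integral_pontryagin_mul, smul_mul_assoc, map_smul, smul_eq_mul, integral_lam_pow_mul,
    integral_pontryagin_theta_pow_mul hc hk]

/-- The identity with the denominator cleared:
`(n−k)! • (z ⋆ θ^k) = (k!·(∏ c_p)·vol) • Λ^{n−k} z`. -/
theorem factorial_smul_pontryagin_theta_pow {c : ι → ℂ} (hc : ∀ p, c p ≠ 0) {k : ℕ}
    (hk : k ≤ Fintype.card ι) (z : A ι) :
    ((Fintype.card ι - k).factorial : ℂ) • pontryagin z (theta c ^ k) =
      (((k.factorial : ℂ) * ∏ p, c p) * vol ι) • (lam c ^ (Fintype.card ι - k)) z := by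
  rw [pontryagin_theta_pow_eq_smul_lam_pow hc hk, smul_smul, kappa']
  have hfac : ((Fintype.card ι - k).factorial : ℂ) ≠ 0 := by
    exact_mod_cast Nat.factorial_ne_zero _
  congr 1
  field_simp

/-- **The top power**: `z ⋆ θ^n = n!·(∏ c_p)·vol • z` — the Pontryagin product with the volume
class `θ^n` is a scalar. -/
theorem pontryagin_theta_pow_card {c : ι → ℂ} (hc : ∀ p, c p ≠ 0) (z : A ι) :
    pontryagin z (theta c ^ Fintype.card ι) =
      ((((Fintype.card ι).factorial : ℂ) * ∏ p, c p) * vol ι) • z := by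
  rw [pontryagin_theta_pow_eq_smul_lam_pow hc le_rfl, Nat.sub_self, pow_zero,
    Module.End.one_apply, kappa', Nat.sub_self, Nat.factorial_zero, Nat.cast_one, div_one]

/-- **The unit**: `z ⋆ 1 = (∏ c_p)·vol / n! • Λ^n z` (the Pontryagin product with the unit class
is the top power of `Λ` — the pairing of `z` with the volume form). -/
theorem pontryagin_one {c : ι → ℂ} (hc : ∀ p, c p ≠ 0) (z : A ι) :
    pontryagin z 1 = ((∏ p, c p) * vol ι / ((Fintype.card ι).factorial : ℂ)) •
      (lam c ^ Fintype.card ι) z := by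
  have h := pontryagin_theta_pow_eq_smul_lam_pow hc (Nat.zero_le (Fintype.card ι)) (c := c) z
  rw [pow_zero, Nat.sub_zero] at h
  rw [h, kappa', Nat.sub_zero, Nat.factorial_zero, Nat.cast_one, one_mul]

end Summit.Ventures.HodgeRepro2.A2PontryaginLefschetz
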